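import Mathlib
import HarnessLib
import Summits.HubbardSuperconductivity.HubbardSuperconductivity.Theorems.KLProgrammeKLRegimeWickDressedLines
import Summits.HubbardSuperconductivity.HubbardSuperconductivity.Theorems.KLProgrammeKLRegimeEngineSelfEnergySymmetric

/-!
# Route `KLProgramme` — crux K3, ENGINE child (stmt-HubbardSuperconductivity-20437 `KLRegimeEngineV17F2`), stub `stub_engine_step_values`, conjunct (E2-F2):
# REALITY of the DRESSED rung — the Σ-dressed slice lines are time-reversal covariant, so the Cooper pair product is `|g̃|² ≥ 0`

Cell gate-hubbard-kl, seat hubbard-kl-p1 (g10; (E2) Wick-toolkit lane, organisation (R1′)).  The dressed slice symbol of the step `n → n+1` is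
`g̃ = s/(1 + sκ)` with the slice symbol `s(k,σ) = (w_{Λ_{n+1}} − w_{Λ_n})(k)·βL²·(iω + e_K)/(ω² + e_K²)` and the two-leg symbol `κ(k,σ) = 2·kernel₂ 𝒱_n = Σ_n(k,σ)/(βL²)`
(`klw_wickAction_succ_dressed`, p524233).  KLTC-INDEX-v4 §C asks for the REALITY of the aggregated dressed weight; it follows from three symmetries already in the tree:
time reversal `Σ_n(−ω,k⃗) = conj Σ_n(ω,k⃗)` (`klSelfEnergy_revFreq`), parity `Σ_n(ω,−k⃗) = Σ_n(ω,k⃗)` (`klSelfEnergy_neg`), spin independence (`klSelfEnergy_spin_eq`), and the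
same three for `s` (real cutoff weights, `e_K` even).  Hence

* `klw_sliceSymbol_revFreq/_neg/_spin`, `klw_twoLegSymbol_revFreq/_neg/_spin`, `klw_dressedSymbol_revFreq/_neg/_spin`;
* **`klw_dressedSymbol_pair_eq_normSq`** — `g̃(ω,k⃗,σ)·g̃(−ω,−k⃗,σ′) = |g̃(ω,k⃗,σ)|²` (the Cooper-pair product of two dressed slice lines at total momentum `Q = 0` is REAL and
  NONNEGATIVE, mode by mode), and `klw_sum_dressedSymbol_pair_eq` (summed over frequencies: a real nonnegative number).

Exact algebra; nothing about sizes or superconductivity is asserted.  0 kit.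
-/

noncomputable section

namespace Summit.HubbardSuperconductivity.HubbardSuperconductivity.Theorems.KLRegimeWick

set_option linter.dupNamespace false -- summit = problem name (single-conjunct summit), D-0017

open Literature.MathematicalPhysics.QuantumLattice GrassmannAlgebra Finset Matrix
open Literature.Probability.LatticeModels
open Summit.HubbardSuperconductivity.HubbardSuperconductivity.Theorems.KLProgrammeLegKernels
open Summit.HubbardSuperconductivity.HubbardSuperconductivity.Theorems.KLRegimeSplit
open scoped ComplexConjugate

section Model

variable (L M : ℕ) [NeZero L] [NeZero M] (β U μ : ℝ) (K : TrigPolyC4v)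

/-! ## §1 The slice symbol -/

omit [NeZero L] [NeZero M] in
/-- Time reversal of the slice symbol: `s(−ω,k⃗,σ) = conj s(ω,k⃗,σ)` (real cutoff weights, even denominator, `conj(iω + e) = i(−ω) + e`). -/
theorem klw_sliceSymbol_revFreq (n : ℕ) (s : FreqMomentum L M × Fin 2 → ℂ)
    (hs : s = fun ks =>
      ((hubbardCutoffWeightCT L M β μ K (klScale klE0 (n + 1)) ks.1 : ℂ) - (hubbardCutoffWeightCT L M β μ K (klScale klE0 n) ks.1 : ℂ)) *
        (((β * (L : ℝ) ^ 2 : ℝ) : ℂ) * ((Complex.I * matsubaraFreq β M ks.1.1 + nambuXiCT L μ K ks.1.2) / nambuDenCT L M β μ 0 K ks.1)))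
    (ω : MatsubaraIdx M) (k : TorusSite 2 L) (σ : Fin 2) :
    s ((ω.rev, k), σ) = conj (s ((ω, k), σ)) := by
  subst hs
  have hw1 : hubbardCutoffWeightCT L M β μ K (klScale klE0 (n + 1)) (ω.rev, k) = hubbardCutoffWeightCT L M β μ K (klScale klE0 (n + 1)) (ω, k) :=
    hubbardCutoffWeightCT_revFreq L M β μ K _ (ω, k)
  have hw0 : hubbardCutoffWeightCT L M β μ K (klScale klE0 n) (ω.rev, k) = hubbardCutoffWeightCT L M β μ K (klScale klE0 n) (ω, k) :=
    hubbardCutoffWeightCT_revFreq L M β μ K _ (ω, k)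
  have hd : nambuDenCT L M β μ 0 K (ω.rev, k) = nambuDenCT L M β μ 0 K (ω, k) := nambuDenCT_revFreq L M β μ 0 K ω k
  simp only [hw1, hw0, hd, matsubaraFreq_rev, Complex.ofReal_neg, map_mul, map_sub, map_div₀, map_add, Complex.conj_ofReal, Complex.conj_I]
  ring

omit [NeZero M] in
/-- Parity of the slice symbol: `s(ω,−k⃗,σ) = s(ω,k⃗,σ)` (`e_K` even: band and frame are). -/
theorem klw_sliceSymbol_neg (n : ℕ) (s : FreqMomentum L M × Fin 2 → ℂ)
    (hs : s = fun ks =>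
      ((hubbardCutoffWeightCT L M β μ K (klScale klE0 (n + 1)) ks.1 : ℂ) - (hubbardCutoffWeightCT L M β μ K (klScale klE0 n) ks.1 : ℂ)) *
        (((β * (L : ℝ) ^ 2 : ℝ) : ℂ) * ((Complex.I * matsubaraFreq β M ks.1.1 + nambuXiCT L μ K ks.1.2) / nambuDenCT L M β μ 0 K ks.1)))
    (ω : MatsubaraIdx M) (k : TorusSite 2 L) (σ : Fin 2) :
    s ((ω, -k), σ) = s ((ω, k), σ) := by
  subst hs
  simp only [hubbardCutoffWeightCT, nambuDenCT, nambuXiCT_neg, zero_mul]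

omit [NeZero L] [NeZero M] in
/-- Spin independence of the slice symbol (it reads the momentum label only). -/
theorem klw_sliceSymbol_spin (n : ℕ) (s : FreqMomentum L M × Fin 2 → ℂ)
    (hs : s = fun ks =>
      ((hubbardCutoffWeightCT L M β μ K (klScale klE0 (n + 1)) ks.1 : ℂ) - (hubbardCutoffWeightCT L M β μ K (klScale klE0 n) ks.1 : ℂ)) *
        (((β * (L : ℝ) ^ 2 : ℝ) : ℂ) * ((Complex.I * matsubaraFreq β M ks.1.1 + nambuXiCT L μ K ks.1.2) / nambuDenCT L M β μ 0 K ks.1)))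
    (q : FreqMomentum L M) (σ σ' : Fin 2) : s (q, σ) = s (q, σ') := by
  subst hs; rfl

/-! ## §2 The two-leg symbol `κ = 2·kernel₂ 𝒱_n = Σ_n/(βL²)` -/

omit [NeZero M] in
/-- Time reversal of the two-leg symbol: `κ(−ω,k⃗,σ) = conj κ(ω,k⃗,σ)` (`klSelfEnergy_revFreq`). -/
theorem klw_twoLegSymbol_revFreq {β : ℝ} (hβ : β ≠ 0) (U μ : ℝ) (K : TrigPolyC4v) (n : ℕ) (κ : FreqMomentum L M × Fin 2 → ℂ)
    (hκ : κ = fun ks => 2 * kernel ℂ (klEffectiveAction L M β U μ K klE0 n) 2 ![((ks, 0) : HubbardFieldIdx L M), (ks, 1)])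
    (ω : MatsubaraIdx M) (k : TorusSite 2 L) (σ : Fin 2) :
    κ ((ω.rev, k), σ) = conj (κ ((ω, k), σ)) := by
  subst hκ
  have h1 : selfEnergy L M β (klEffectiveAction L M β U μ K klE0 n) (ω.rev, k) σ =
      conj (selfEnergy L M β (klEffectiveAction L M β U μ K klE0 n) (ω, k) σ) :=
    klSelfEnergy_revFreq L M β U μ K klE0 n ω k σ
  show 2 * kernel ℂ (klEffectiveAction L M β U μ K klE0 n) 2 ![(((ω.rev, k), σ), 0), (((ω.rev, k), σ), 1)] =
    conj (2 * kernel ℂ (klEffectiveAction L M β U μ K klE0 n) 2 ![(((ω, k), σ), 0), (((ω, k), σ), 1)])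
  rw [two_mul_kernel_two_eq_selfEnergy_div hβ, two_mul_kernel_two_eq_selfEnergy_div hβ, h1, map_div₀, Complex.conj_ofReal]

omit [NeZero M] in
/-- Parity of the two-leg symbol: `κ(ω,−k⃗,σ) = κ(ω,k⃗,σ)` (`klSelfEnergy_neg`). -/
theorem klw_twoLegSymbol_neg {β : ℝ} (hβ : β ≠ 0) (U μ : ℝ) (K : TrigPolyC4v) (n : ℕ) (κ : FreqMomentum L M × Fin 2 → ℂ)
    (hκ : κ = fun ks => 2 * kernel ℂ (klEffectiveAction L M β U μ K klE0 n) 2 ![((ks, 0) : HubbardFieldIdx L M), (ks, 1)])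
    (ω : MatsubaraIdx M) (k : TorusSite 2 L) (σ : Fin 2) :
    κ ((ω, -k), σ) = κ ((ω, k), σ) := by
  subst hκ
  have h1 : selfEnergy L M β (klEffectiveAction L M β U μ K klE0 n) (ω, -k) σ = selfEnergy L M β (klEffectiveAction L M β U μ K klE0 n) (ω, k) σ :=
    klSelfEnergy_neg L M β U μ K klE0 n ω k σ
  show 2 * kernel ℂ (klEffectiveAction L M β U μ K klE0 n) 2 ![(((ω, -k), σ), 0), (((ω, -k), σ), 1)] =
    2 * kernel ℂ (klEffectiveAction L M β U μ K klE0 n) 2 ![(((ω, k), σ), 0), (((ω, k), σ), 1)]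
  rw [two_mul_kernel_two_eq_selfEnergy_div hβ, two_mul_kernel_two_eq_selfEnergy_div hβ, h1]

omit [NeZero M] in
/-- Spin independence of the two-leg symbol (`klSelfEnergy_spin_eq`). -/
theorem klw_twoLegSymbol_spin {β : ℝ} (hβ : β ≠ 0) (U μ : ℝ) (K : TrigPolyC4v) (n : ℕ) (κ : FreqMomentum L M × Fin 2 → ℂ)
    (hκ : κ = fun ks => 2 * kernel ℂ (klEffectiveAction L M β U μ K klE0 n) 2 ![((ks, 0) : HubbardFieldIdx L M), (ks, 1)])
    (q : FreqMomentum L M) (σ σ' : Fin 2) : κ (q, σ) = κ (q, σ') := by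
  subst hκ
  have h1 : selfEnergy L M β (klEffectiveAction L M β U μ K klE0 n) q σ = selfEnergy L M β (klEffectiveAction L M β U μ K klE0 n) q σ' := by
    rw [show selfEnergy L M β (klEffectiveAction L M β U μ K klE0 n) q σ = klSelfEnergy L M β U μ K klE0 n q σ from rfl,
      show selfEnergy L M β (klEffectiveAction L M β U μ K klE0 n) q σ' = klSelfEnergy L M β U μ K klE0 n q σ' from rfl,
      klSelfEnergy_spin_eq L M β U μ K klE0 n q σ, klSelfEnergy_spin_eq L M β U μ K klE0 n q σ']
  show 2 * kernel ℂ (klEffectiveAction L M β U μ K klE0 n) 2 ![((q, σ), 0), ((q, σ), 1)] =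
    2 * kernel ℂ (klEffectiveAction L M β U μ K klE0 n) 2 ![((q, σ'), 0), ((q, σ'), 1)]
  rw [two_mul_kernel_two_eq_selfEnergy_div hβ, two_mul_kernel_two_eq_selfEnergy_div hβ, h1]

/-! ## §3 The dressed symbol and the Cooper-pair product -/

omit [NeZero L] [NeZero M] in
/-- A symbol covariant under time reversal, parity and spin exchange has a Cooper-pair product `f(ω,k⃗,σ)·f(−ω,−k⃗,σ′) = |f(ω,k⃗,σ)|²`. -/
theorem pair_eq_normSq_of_symm (f : FreqMomentum L M × Fin 2 → ℂ)
    (hrev : ∀ ω k σ, f ((ω.rev, k), σ) = conj (f ((ω, k), σ))) (hneg : ∀ ω k σ, f ((ω, -k), σ) = f ((ω, k), σ))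
    (hspin : ∀ q σ σ', f (q, σ) = f (q, σ')) (ω : MatsubaraIdx M) (k : TorusSite 2 L) (σ σ' : Fin 2) :
    f ((ω, k), σ) * f ((ω.rev, -k), σ') = ((‖f ((ω, k), σ)‖ ^ 2 : ℝ) : ℂ) := by
  rw [hspin _ σ' σ, hrev, hneg, Complex.mul_conj, Complex.normSq_eq_norm_sq, Complex.ofReal_pow]

omit [NeZero L] [NeZero M] in
/-- The DRESSED symbol `s/(1+sκ)` inherits time reversal, parity and spin symmetry from `s` and `κ`. -/
theorem dressedSymbol_symm (s κ : FreqMomentum L M × Fin 2 → ℂ)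
    (hsrev : ∀ ω k σ, s ((ω.rev, k), σ) = conj (s ((ω, k), σ))) (hsneg : ∀ ω k σ, s ((ω, -k), σ) = s ((ω, k), σ))
    (hsspin : ∀ q σ σ', s (q, σ) = s (q, σ'))
    (hkrev : ∀ ω k σ, κ ((ω.rev, k), σ) = conj (κ ((ω, k), σ))) (hkneg : ∀ ω k σ, κ ((ω, -k), σ) = κ ((ω, k), σ))
    (hkspin : ∀ q σ σ', κ (q, σ) = κ (q, σ')) :
    (∀ ω k σ, (fun ks => s ks / (1 + s ks * κ ks)) ((ω.rev, k), σ) = conj ((fun ks => s ks / (1 + s ks * κ ks)) ((ω, k), σ))) ∧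
      (∀ ω k σ, (fun ks => s ks / (1 + s ks * κ ks)) ((ω, -k), σ) = (fun ks => s ks / (1 + s ks * κ ks)) ((ω, k), σ)) ∧
      (∀ q σ σ', (fun ks => s ks / (1 + s ks * κ ks)) (q, σ) = (fun ks => s ks / (1 + s ks * κ ks)) (q, σ')) := by
  refine ⟨fun ω k σ => ?_, fun ω k σ => ?_, fun q σ σ' => ?_⟩
  · simp only [hsrev, hkrev, map_div₀, map_add, map_one, map_mul]
  · simp only [hsneg, hkneg]
  · simp only [hsspin q σ σ', hkspin q σ σ']

omit [NeZero M] in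
/-- **`klw_dressedSymbol_pair_eq_normSq` — reality of the dressed rung.**  With the slice symbol `s` and the two-leg symbol `κ` of the dressed step
(`β ≠ 0`), the dressed line `g̃ = s/(1+sκ)` satisfies `g̃(ω,k⃗,σ)·g̃(−ω,−k⃗,σ′) = |g̃(ω,k⃗,σ)|²`: the Cooper-pair product of two DRESSED slice lines at total
momentum `Q = 0` is real and nonnegative, mode by mode (KLTC-INDEX-v4 §C «reality of the aggregated dressed weight»). -/
theorem klw_dressedSymbol_pair_eq_normSq {β : ℝ} (hβ : β ≠ 0) (U μ : ℝ) (K : TrigPolyC4v) (n : ℕ) (s κ : FreqMomentum L M × Fin 2 → ℂ)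
    (hs : s = fun ks =>
      ((hubbardCutoffWeightCT L M β μ K (klScale klE0 (n + 1)) ks.1 : ℂ) - (hubbardCutoffWeightCT L M β μ K (klScale klE0 n) ks.1 : ℂ)) *
        (((β * (L : ℝ) ^ 2 : ℝ) : ℂ) * ((Complex.I * matsubaraFreq β M ks.1.1 + nambuXiCT L μ K ks.1.2) / nambuDenCT L M β μ 0 K ks.1)))
    (hκ : κ = fun ks => 2 * kernel ℂ (klEffectiveAction L M β U μ K klE0 n) 2 ![((ks, 0) : HubbardFieldIdx L M), (ks, 1)])
    (ω : MatsubaraIdx M) (k : TorusSite 2 L) (σ σ' : Fin 2) :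
    (s ((ω, k), σ) / (1 + s ((ω, k), σ) * κ ((ω, k), σ))) * (s ((ω.rev, -k), σ') / (1 + s ((ω.rev, -k), σ') * κ ((ω.rev, -k), σ'))) =
      ((‖s ((ω, k), σ) / (1 + s ((ω, k), σ) * κ ((ω, k), σ))‖ ^ 2 : ℝ) : ℂ) := by
  obtain ⟨h1, h2, h3⟩ := dressedSymbol_symm L M s κ (klw_sliceSymbol_revFreq L M β μ K n s hs) (klw_sliceSymbol_neg L M β μ K n s hs)
    (klw_sliceSymbol_spin L M β μ K n s hs) (klw_twoLegSymbol_revFreq L M hβ U μ K n κ hκ) (klw_twoLegSymbol_neg L M hβ U μ K n κ hκ)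
    (klw_twoLegSymbol_spin L M hβ U μ K n κ hκ)
  exact pair_eq_normSq_of_symm L M (fun ks => s ks / (1 + s ks * κ ks)) h1 h2 h3 ω k σ σ'

omit [NeZero M] in
/-- **`klw_sum_dressedSymbol_pair_eq`** — summed over the Matsubara frequencies the dressed Cooper-pair weight is the real nonnegative number
`Σ_ω |g̃(ω,k⃗,σ)|²`. -/
theorem klw_sum_dressedSymbol_pair_eq {β : ℝ} (hβ : β ≠ 0) (U μ : ℝ) (K : TrigPolyC4v) (n : ℕ) (s κ : FreqMomentum L M × Fin 2 → ℂ)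
    (hs : s = fun ks =>
      ((hubbardCutoffWeightCT L M β μ K (klScale klE0 (n + 1)) ks.1 : ℂ) - (hubbardCutoffWeightCT L M β μ K (klScale klE0 n) ks.1 : ℂ)) *
        (((β * (L : ℝ) ^ 2 : ℝ) : ℂ) * ((Complex.I * matsubaraFreq β M ks.1.1 + nambuXiCT L μ K ks.1.2) / nambuDenCT L M β μ 0 K ks.1)))
    (hκ : κ = fun ks => 2 * kernel ℂ (klEffectiveAction L M β U μ K klE0 n) 2 ![((ks, 0) : HubbardFieldIdx L M), (ks, 1)])
    (k : TorusSite 2 L) (σ σ' : Fin 2) :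
    ∑ ω : MatsubaraIdx M, (s ((ω, k), σ) / (1 + s ((ω, k), σ) * κ ((ω, k), σ))) *
        (s ((ω.rev, -k), σ') / (1 + s ((ω.rev, -k), σ') * κ ((ω.rev, -k), σ'))) =
      ((∑ ω : MatsubaraIdx M, ‖s ((ω, k), σ) / (1 + s ((ω, k), σ) * κ ((ω, k), σ))‖ ^ 2 : ℝ) : ℂ) := by
  rw [Complex.ofReal_sum]
  exact Finset.sum_congr rfl fun ω _ => klw_dressedSymbol_pair_eq_normSq L M hβ U μ K n s κ hs hκ ω k σ σ'

end Model

end Summit.HubbardSuperconductivity.HubbardSuperconductivity.Theorems.KLRegimeWick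

end
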